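import Summits.HodgeConjecture.HodgeConjecture.Theorems.VHCAbelianSchemesRoadMoverConfinementOfKSimple
import Summits.HodgeConjecture.HodgeConjecture.Theorems.VHCAbelianSchemesRoadSecantQuotientPsiBar
import Literature.AlgebraicGeometry.Motives.AbelianVarietySubvarietyCofiniteAnnihilator
import HarnessLib

/-!
# Road №4 (`VHCAbelianSchemesRoad`), crux stmt-HodgeConjecture-26512 — lens line «negation» (mover trap), kernel node S2 BY NAME:
# `MoverTrap.moverConfinement_of_KSimple` = `stub_moverConfinement_of_KSimple` VERBATIM

research route conditional on HC_CM; not a corollary; Q11.4-sentence-2 already refuted in dim ≥ 3.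
NOTHING here says S1, S4, (c4a), (c4a-E) `PrintSheafHandleExistsEnd`, the crux, №4, HC_AV, HC_CM or HC holds; `Raynaud1983_maninMumford` is a NAMED
FACT and stays the ANTECEDENT of the theorem, exactly as in the registered stub; HC_CM HELD, by name only.

The THIN CLOSER of S2 (piece P3 ∕ (L-B) of core-w5 g3's cut, INBOX l.5817 and l.5833; seat core-w3 g2; director-hodge g16 R16.55 ∕ R16.57): the
statement of `Cruxes/DiagLocalOfMarkmanPinnedForall/Lines/MoverTrap.lean` l.247 `stub_moverConfinement_of_KSimple` VERBATIM over
`Theorems/VHCAbelianSchemesRoadMoverTrapDefs.lean` (`KSimple`), obtained from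

* the ENGINE `MoverTrap.moverConfinement_of_KSimple_of` (core-w5 g3, `Theorems/VHCAbelianSchemesRoadMoverConfinementOfKSimple.lean`: Raynaud BY NAME
  on `(Y, V, ι)` + the finite ψ̄-stable cores of (L-A) `finite_psiBarStableCore_of_exists_annihilator` + the bad set of orders), whose two displayed
  kernel inputs are discharged here by
* P1 `AbelianVariety.exists_cofinite_annihilator_of_range_ne_univ` (core-w3 g2, `Literature/AlgebraicGeometry/Motives/AbelianVarietySubvarietyCofiniteAnnihilator.lean`:
  Poincaré complement + quasi-inverse) and
* P2 `SecantQuotientDatum.exists_psiBar`, `SecantQuotientDatum.IsMover.pointsMap_psiBar_eq`, `SecantQuotientDatum.IsMover.zpow_sq_add_eq_one`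
  (core-w1 g2, `Theorems/VHCAbelianSchemesRoadSecantQuotientPsiBar.lean`: the descent `ψ̄` of `φ_d` to `Y` and the mover points arithmetic).

References: [cite: Raynaud1983SousVarietes, Théorème principal (p. 327)] [cite: MumfordAV1970, §7 Thm. 4 (p. 72) and §19 Thm. 1 (p. 173)]
[cite: Markman2025SecantWeil, §1.5 (p. 7) and §9.3 Lemma 9.3.3]
-/

noncomputable section

open CategoryTheory CategoryTheory.Limits AlgebraicGeometry Topology

namespace Summit.HodgeConjecture.HodgeConjecture.Ring2.SemiregularRepresentatives

set_option linter.dupNamespace false -- the cell's namespace repeats the summit name, as in every `Ring2*` file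

namespace MoverTrap

open Literature.AlgebraicGeometry Literature.AlgebraicGeometry.Motives Literature.AlgebraicGeometry.Motives.AbelianVariety
open Literature.AlgebraicGeometry.HodgeTheory Literature.AlgebraicGeometry.Markman2025

/-- **S2 — MOVER CONFINEMENT AT K-SIMPLE DATA** (the workfile's `stub_moverConfinement_of_KSimple` VERBATIM): granted Raynaud 1983 (BY NAME), at a
K-simple secant–quotient datum every closed subscheme `ι : V ↪ Y` with `V(ℂ) ≠ Y(ℂ)` admits a finite set `T` of orders `> 1` such that every mover
`ḡ_{u_m}` with `m² + d` prime to `T` has `Ker ḡ_{u_m}(ℂ) ∩ V(ℂ) ⊆ {1}` — the engine `moverConfinement_of_KSimple_of` fed with P1 (cofinite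
annihilators) and P2 (`ψ̄`, `ψ̄ x = x^{-m}`, `x^{m²+d} = 1` on mover kernels).
[cite: Raynaud1983SousVarietes, Théorème principal (p. 327)] [cite: MumfordAV1970, §19 Thm. 1 (p. 173)] [cite: Markman2025SecantWeil, §9.3 Lemma 9.3.3] -/
theorem moverConfinement_of_KSimple :
    Raynaud1983_maninMumford →
    ∀ (D : SecantQuotientDatum), KSimple D →
      ∀ (V : SchemeOver ℂ) (ι : V ⟶ D.Y.X), IsClosedImmersion ι.left →
        Set.range (AlgPoints.map (L := ℂ) ι) ≠ Set.univ →
        ∃ T : Finset ℕ, (∀ N ∈ T, 1 < N) ∧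
          ∀ (m : ℤ) (g : D.Y ⟶ D.Y), D.IsMover m g → (∀ N ∈ T, ¬ ((N : ℤ) ∣ m ^ 2 + (D.d : ℤ))) →
            ∀ x : D.Y.Points ℂ, x ∈ Hom.kerPoints (specOver ℂ ℂ) g → x ≠ 1 → x ∉ Set.range (AlgPoints.map (L := ℂ) ι) := by
  intro hR D hK V ι hι hV
  obtain ⟨ψbar, hψbar⟩ := D.exists_psiBar
  exact moverConfinement_of_KSimple_of hR D hK hψbar
    (fun C g hg => exists_cofinite_annihilator_of_range_ne_univ g hg)
    (fun m g hg x hx =>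
      ⟨SecantQuotientDatum.IsMover.pointsMap_psiBar_eq hψbar hg hx, SecantQuotientDatum.IsMover.zpow_sq_add_eq_one hg hx⟩)
    V ι hι hV

end MoverTrap

end Summit.HodgeConjecture.HodgeConjecture.Ring2.SemiregularRepresentatives

end
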